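import Summits.QuantumFields.BalabanUV.Beta.BubbleParity

/-!
# The ROOTED `j = 0` first-order spine in the NATIVE (sgn-antisymmetric) placement: `S0NAt ρ` — `S0At ρ` WITHOUT the `mfNeg` adapter
# (β sub-cell, row BETA-an2, gen 14; NOTE X-an2-45 / proposed (R45-1); a candidate object BESIDE the existing spine, touching nothing)

HONEST FRAMING (cell charter, verbatim): «discharging BetaPertH makes Balaban's UV stability UNCONDITIONAL — a real
constructive-QFT result; it is NOT the continuum limit and NOT the Clay problem.»  DERIVED cell leaf (pub-balaban β sub-cell, lane
an2 gen 14); no statement of Bałaban's papers is typed here, no `[cite:]` tag, no `Prop` fact; it instantiates no binder of the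
β-function wall by itself.  NOT `BetaPertH`; NOT continuum; NOT Clay.

## What is here

NOTE X-an2-45 (kernel anchor `BubbleParity`, exact toys `HOME/b2b-balaban-beta-an2/gen14/toy/`): the packed resolvent `KInv` is
sgn-symmetric, so the colourless first-order stencil that goes with it is the stripped jet of `𝕂 = B·D₂`, which is sgn-ANTIsymmetric —
field block antisymmetric (`wilsonA`), field–multiplier blocks in SYMMETRIC placement (an1's native `packVH` twin).  The spine `SpineRooted.S0At`
(v2.21–v2.23 literals) applies the (F2) adapter `mfNeg` and is plain-antisymmetric instead.  Pending the β-lead's ruling (R45), this file types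
the candidate re-issue BESIDE the old object (new names; nothing deleted or edited):

* `S0NAt ρ cE cVH cΛ κ′ u := cE • wilsonA κ′ u + cVH • vhSAt ρ d Lc κ′ u + cΛ • SLam Lc (lamCoeffOf (KInv Lc) Lc) (hessFFAt ρ Lc) κ′ u`
  (literally `S0At` with `mfNeg (vhSAt …)` replaced by `vhSAt …`);
* `locStencil_S0NAt` (same constants as `locStencil_S0At`), `S0NAt_translate` (block covariance);
* the PARITY: `S0NAt_split` (vh-part `S0NAt ρ 0 cVH 0` + Wilson/Λ-part `S0NAt ρ cE 0 cΛ = S0At ρ cE 0 cΛ`, `S0NAt_wl_eq_S0At_wl`),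
  `S0NAt_vh_symm` (the vh-part is plain-SYMMETRIC), `sgnK_S0NAt_vh` (and `sgnK`-negated), `sgnK_S0NAt_wl`; hence
  **`S0NAt_sgn_antisymm`** / **`trK_S0NAt : trK (S0NAt ρ cE cVH cΛ κ′ u) = −sgnK (S0NAt ρ cE cVH cΛ κ′ u)`** — sgn-ANTIsymmetric, the parity
  of `conjV (bhK) (diagonal)`;
* the datum `jsBal0NAtOf` (`JetData`, any admissible second-order family `W`) with `_S`/`_W` by `rfl`.

Nothing downstream is re-pointed here (the composite/step members `Sc`/`Sstep`, the dressed spines and the wall literal are the lead's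
call, (R45-1)/(R45-3)).  All declarations `[folklore]`; axioms standard.  Provenance: b2b-balaban β sub-cell, unit beta-an2 gen 14, 2026-08-20
(v1); over `SpineRootedS0` (an2 gen 11), an1's `AveragingHessianKernelsRooted`, `BubbleParity` (gen 14) BY NAME; no existing file touched.
-/

open Finset
open scoped BigOperators
open Literature.MathematicalPhysics.QuantumFieldTheory
open Literature.MathematicalPhysics.QuantumFieldTheory.Balaban1983to89
open Literature.MathematicalPhysics.QuantumFieldTheory.Balaban1983to89.Beta
open B12Sec2to5 (l1 l1_nonneg)
open ExpKernelCalculus (MKer Decays BiLoc VertexFamily VertexFamily₂ shiftK)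
open OneStepResolventKernel (Fib LocStencil JetData KInv decays_KInv shiftK_KInv)
open AffineAveraging (box toSite)
open StepJetData (wilsonA wBound locStencil_wilsonA wilsonA_translate wilsonA_antisymm locStencil_add locStencil_smul)
open AveragingHessianKernels (ell)
open AveragingHessianKernelsRooted (vhSAt locStencil_vhSAt vhSAt_translate vhSAt_symm hessFFAt hessFFAt_antisymm biLoc_hessFFAt
  hessFFAt_translate)
open InterLevelTransport (SLam locStencil_SLam SLam_translate)
open BalabanStepJets (lamCoeffOf abs_lamCoeffOf_le lamCoeffOf_translate cwsum_antisymm locStencil_mono vertexFamily₂_mono)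
open Summit.QuantumFields.BalabanUV.Beta.TameKernelCalculus
open Summit.QuantumFields.BalabanUV.Beta.BorderedHessian (sgnF sgnF_inl sgnF_inr sgnK sgnK_apply sgnK_eq_self)
open Summit.QuantumFields.BalabanUV.Beta.BubbleParity (sgnK_eq_neg_of_offDiag S0At_wl_inl_inr S0At_wl_inr_inl)

noncomputable section

namespace Summit.QuantumFields.BalabanUV.Beta.SpineRooted

/-! ## §1 The native-placement `j = 0` stencil -/

section StepZero

variable (d : ℕ) (Lc : ℕ) [NeZero Lc]

/-- [folklore] **THE `j = 0` FIRST-ORDER SPINE IN THE NATIVE PLACEMENT** (comb root `Lc•blk + ρ`):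
`S0NAt ρ κ′ u := cE • wilsonA κ′ u + cVH • vhSAt ρ d Lc κ′ u + cΛ • SLam Lc (lamCoeffOf (KInv Lc) Lc) (hessFFAt ρ Lc) κ′ u` — `S0At` without `mfNeg`. -/
def S0NAt (ρ : Fin (d + 1) → ℤ) (cE cVH cΛ : ℝ) : Fin (d + 1) → (Fin (d + 1) → ℤ) → ExpKernelCalculus.MKer (d + 1) (Fib d) :=
  fun κ' u =>
    cE • wilsonA d κ' u + cVH • vhSAt ρ d Lc rfl κ' u +
      cΛ • SLam Lc (lamCoeffOf (KInv (N := Lc) (d := d)) Lc) (fun μ y => hessFFAt ρ Lc μ y) κ' u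

variable {d Lc}

/-- [folklore] **`S0NAt ρ` IS A LOCAL STENCIL FAMILY** for in-block roots (same constants as `locStencil_S0At`). -/
theorem locStencil_S0NAt (hLc : 1 ≤ Lc) {r : Fin (d + 1) → ℕ} (hr : r ∈ box (d + 1) Lc) (cE cVH cΛ : ℝ) :
    ∃ Cs δ : ℝ, 0 < δ ∧ LocStencil (S0NAt d Lc (toSite r) cE cVH cΛ) Cs δ := by
  obtain ⟨δ₀, C, hδ₀, hC, hdec⟩ := decays_KInv (N := Lc) (d := d)
  have hδ2 : (0 : ℝ) ≤ δ₀ / 2 := by positivity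
  have h1 : LocStencil (wilsonA d) (wBound d * Real.exp (4 * (δ₀ / 2))) (δ₀ / 2) := locStencil_wilsonA hδ2
  have h2 : LocStencil (vhSAt (toSite r) d Lc rfl)
      (3 * (ell (d + 1) Lc : ℝ) ^ 2 * Real.exp (4 * ((d : ℝ) + 1) * Lc * (δ₀ / 2))) (δ₀ / 2) := locStencil_vhSAt hLc hr hδ2
  have hc := abs_lamCoeffOf_le (N := Lc) hdec hC hδ₀.le
  have hQ : VertexFamily (fun μ y => hessFFAt (toSite r) Lc μ y) Lc
      (2 * (ell (d + 1) Lc : ℝ) ^ 2 * Real.exp (4 * ((d : ℝ) + 1) * Lc * δ₀)) δ₀ :=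
    fun μ y => biLoc_hessFFAt hLc μ y hr hδ₀.le
  have h3 := locStencil_SLam (N := Lc) hc hQ hδ₀ (mul_nonneg (mul_nonneg (by positivity) hC) (Real.exp_pos _).le)
  exact ⟨_, δ₀ / 2, by positivity,
    locStencil_add (locStencil_add (locStencil_smul cE h1) (locStencil_smul cVH h2)) (locStencil_smul cΛ h3)⟩

/-- [folklore] **BLOCK-TRANSLATION COVARIANCE OF `S0NAt ρ`** (all roots). -/
theorem S0NAt_translate (ρ : Fin (d + 1) → ℤ) (hLc : 1 ≤ Lc) (cE cVH cΛ : ℝ) (κ' : Fin (d + 1)) (u t : Fin (d + 1) → ℤ) :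
    S0NAt d Lc ρ cE cVH cΛ κ' (u + (Lc : ℤ) • t) = shiftK (-((Lc : ℤ) • t)) (S0NAt d Lc ρ cE cVH cΛ κ' u) := by
  have h1 := wilsonA_translate (d := d) κ' u ((Lc : ℤ) • t)
  have h2 := vhSAt_translate (d := d) ρ hLc κ' u t
  have h3 := SLam_translate (N := Lc) (c := lamCoeffOf (KInv (N := Lc) (d := d)) Lc) (Q2 := fun μ y => hessFFAt ρ Lc μ y)
    (fun μ y κ'' u' t' => lamCoeffOf_translate (fun s => shiftK_KInv (N := Lc) (d := d) s) μ y κ'' u' t')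
    (fun μ y t' => hessFFAt_translate ρ μ y t') κ' u t
  funext x z a b
  simp only [S0NAt, Pi.add_apply, Pi.smul_apply, smul_eq_mul, shiftK]
  rw [h1, h2, h3]
  rfl

/-! ### Parity: the vh-part is symmetric, the Wilson/Λ-part antisymmetric — `S0NAt` is sgn-ANTIsymmetric -/

variable (d Lc)

/-- [folklore] COEFFICIENT SPLIT: `S0NAt ρ cE cVH cΛ = S0NAt ρ 0 cVH 0 + S0NAt ρ cE 0 cΛ`. -/
theorem S0NAt_split (ρ : Fin (d + 1) → ℤ) (cE cVH cΛ : ℝ) :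
    S0NAt d Lc ρ cE cVH cΛ = fun κ' u => S0NAt d Lc ρ 0 cVH 0 κ' u + S0NAt d Lc ρ cE 0 cΛ κ' u := by
  funext κ' u x z a b
  simp only [S0NAt, Pi.add_apply, Pi.smul_apply, smul_eq_mul, zero_mul, zero_add, add_zero]
  ring

/-- [folklore] The Wilson/Λ-part of `S0NAt` IS that of `S0At` (the adapter only touches the vh-part). -/
theorem S0NAt_wl_eq_S0At_wl (ρ : Fin (d + 1) → ℤ) (cE cΛ : ℝ) : S0NAt d Lc ρ cE 0 cΛ = S0At d Lc ρ cE 0 cΛ := by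
  funext κ' u x z a b
  simp only [S0NAt, S0At, Pi.add_apply, Pi.smul_apply, smul_eq_mul, zero_mul, add_zero]

/-- [folklore] The vh-part of `S0NAt` is `cVH • vhSAt`. -/
theorem S0NAt_vh_apply (ρ : Fin (d + 1) → ℤ) (cVH : ℝ) (κ' : Fin (d + 1)) (u x z : Fin (d + 1) → ℤ) (a b : Fib d) :
    S0NAt d Lc ρ 0 cVH 0 κ' u x z a b = cVH * vhSAt ρ d Lc rfl κ' u x z a b := by
  simp only [S0NAt, Pi.add_apply, Pi.smul_apply, smul_eq_mul, zero_mul, zero_add, add_zero]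

variable {d Lc}

/-- [folklore] **THE vh-PART IS PLAIN-SYMMETRIC** (an1's `packVH` twin). -/
theorem S0NAt_vh_symm (ρ : Fin (d + 1) → ℤ) (cVH : ℝ) (κ' : Fin (d + 1)) (u x z : Fin (d + 1) → ℤ) (a b : Fib d) :
    S0NAt d Lc ρ 0 cVH 0 κ' u z x b a = S0NAt d Lc ρ 0 cVH 0 κ' u x z a b := by
  rw [S0NAt_vh_apply, S0NAt_vh_apply, vhSAt_symm ρ Lc κ' u x z a b]

/-- [folklore] The vh-part has no field–field and no multiplier–multiplier block, hence is NEGATED by `sgnK`. -/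
theorem sgnK_S0NAt_vh (ρ : Fin (d + 1) → ℤ) (cVH : ℝ) (κ' : Fin (d + 1)) (u : Fin (d + 1) → ℤ) :
    sgnK (S0NAt d Lc ρ 0 cVH 0 κ' u) = -S0NAt d Lc ρ 0 cVH 0 κ' u :=
  sgnK_eq_neg_of_offDiag
    (fun x z κ l => by rw [S0NAt_vh_apply]; exact (mul_eq_zero.2 (Or.inr rfl)))
    (fun x z κ l => by rw [S0NAt_vh_apply]; exact (mul_eq_zero.2 (Or.inr rfl)))

/-- [folklore] The Wilson/Λ-part is FIXED by `sgnK` (no mixed blocks). -/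
theorem sgnK_S0NAt_wl (ρ : Fin (d + 1) → ℤ) (cE cΛ : ℝ) (κ' : Fin (d + 1)) (u : Fin (d + 1) → ℤ) :
    sgnK (S0NAt d Lc ρ cE 0 cΛ κ' u) = S0NAt d Lc ρ cE 0 cΛ κ' u := by
  rw [S0NAt_wl_eq_S0At_wl]
  exact sgnK_eq_self (fun x z κ l => S0At_wl_inl_inr ρ cE cΛ κ' u x z κ l) (fun x z κ l => S0At_wl_inr_inl ρ cE cΛ κ' u x z κ l)

/-- [folklore] **`S0NAt ρ` IS sgn-ANTISYMMETRIC**: `S0NAt … κ′ u z x b a = −(sgnF a · sgnF b · S0NAt … κ′ u x z a b)` — the parity of a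
commutator of the sgn-symmetric `bhK` with a DIAGONAL (sgn-fixed) generator (`DiagonalContact`), i.e. of the product-chart contact. -/
theorem S0NAt_sgn_antisymm (ρ : Fin (d + 1) → ℤ) (cE cVH cΛ : ℝ) (κ' : Fin (d + 1)) (u x z : Fin (d + 1) → ℤ) (a b : Fib d) :
    S0NAt d Lc ρ cE cVH cΛ κ' u z x b a = -(sgnF a * sgnF b * S0NAt d Lc ρ cE cVH cΛ κ' u x z a b) := by
  have hsplit := S0NAt_split d Lc ρ cE cVH cΛ
  have hv : S0NAt d Lc ρ 0 cVH 0 κ' u z x b a = -(sgnF a * sgnF b * S0NAt d Lc ρ 0 cVH 0 κ' u x z a b) := by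
    have h := congrFun (congrFun (congrFun (congrFun (sgnK_S0NAt_vh (Lc := Lc) ρ cVH κ' u) x) z) a) b
    simp only [sgnK_apply, Pi.neg_apply] at h
    rw [S0NAt_vh_symm, h, neg_neg]
  have hw : S0NAt d Lc ρ cE 0 cΛ κ' u z x b a = -(sgnF a * sgnF b * S0NAt d Lc ρ cE 0 cΛ κ' u x z a b) := by
    have h := congrFun (congrFun (congrFun (congrFun (sgnK_S0NAt_wl (Lc := Lc) ρ cE cΛ κ' u) x) z) a) b
    simp only [sgnK_apply] at h
    rw [h, S0NAt_wl_eq_S0At_wl]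
    exact S0At_antisymm ρ cE 0 cΛ κ' u x z a b
  have e1 : S0NAt d Lc ρ cE cVH cΛ κ' u z x b a = S0NAt d Lc ρ 0 cVH 0 κ' u z x b a + S0NAt d Lc ρ cE 0 cΛ κ' u z x b a := by
    rw [hsplit]; rfl
  have e2 : S0NAt d Lc ρ cE cVH cΛ κ' u x z a b = S0NAt d Lc ρ 0 cVH 0 κ' u x z a b + S0NAt d Lc ρ cE 0 cΛ κ' u x z a b := by
    rw [hsplit]; rfl
  rw [e1, e2, hv, hw]
  ring

/-- [folklore] The same parity as a kernel identity: `trK (S0NAt … κ′ u) = −sgnK (S0NAt … κ′ u)`. -/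
theorem trK_S0NAt (ρ : Fin (d + 1) → ℤ) (cE cVH cΛ : ℝ) (κ' : Fin (d + 1)) (u : Fin (d + 1) → ℤ) :
    trK (S0NAt d Lc ρ cE cVH cΛ κ' u) = -sgnK (S0NAt d Lc ρ cE cVH cΛ κ' u) := by
  funext x z a b
  simp only [trK_apply, Pi.neg_apply, sgnK_apply]
  exact S0NAt_sgn_antisymm ρ cE cVH cΛ κ' u x z a b

end StepZero

/-! ## §2 Packaging: the rooted `j = 0` datum in the native placement -/

section Packaging

variable {d : ℕ} {Lc : ℕ} [NeZero Lc]

/-- [folklore] **THE ROOTED `j = 0` JET DATUM, NATIVE PLACEMENT** `(S0NAt (toSite r), W)` for any admissible second-order family `W`. -/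
def jsBal0NAtOf (hLc : 1 ≤ Lc) {r : Fin (d + 1) → ℕ} (hr : r ∈ box (d + 1) Lc) (cE cVH cΛ : ℝ)
    (W : Fin (d + 1) → (Fin (d + 1) → ℤ) → Fin (d + 1) → (Fin (d + 1) → ℤ) → ExpKernelCalculus.MKer (d + 1) (Fib d))
    (Cw δw : ℝ) (hδw : 0 < δw) (hW : VertexFamily₂ W Lc Cw δw) : JetData d Lc :=
  have hS := locStencil_S0NAt (d := d) (Lc := Lc) hLc hr cE cVH cΛ
  have hδS : 0 < hS.choose_spec.choose := hS.choose_spec.choose_spec.1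
  have hloc : LocStencil (S0NAt d Lc (toSite r) cE cVH cΛ) hS.choose hS.choose_spec.choose := hS.choose_spec.choose_spec.2
  { S := S0NAt d Lc (toSite r) cE cVH cΛ
    W := W
    Cs := hS.choose
    Cw := Cw
    δ := min hS.choose_spec.choose δw
    δ_pos := lt_min hδS hδw
    loc := locStencil_mono hloc ((hloc 0 0).nonneg (Sum.inl 0)) (min_le_left _ _)
    loc₂ := vertexFamily₂_mono hW ((hW 0 0 0 0).nonneg (Sum.inl 0)) (min_le_right _ _) }

/-- [folklore] The first-order part of the datum is `S0NAt (toSite r)`. -/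
@[simp] theorem jsBal0NAtOf_S (hLc : 1 ≤ Lc) {r : Fin (d + 1) → ℕ} (hr : r ∈ box (d + 1) Lc) (cE cVH cΛ : ℝ)
    (W : Fin (d + 1) → (Fin (d + 1) → ℤ) → Fin (d + 1) → (Fin (d + 1) → ℤ) → ExpKernelCalculus.MKer (d + 1) (Fib d))
    (Cw δw : ℝ) (hδw : 0 < δw) (hW : VertexFamily₂ W Lc Cw δw) :
    (jsBal0NAtOf hLc hr cE cVH cΛ W Cw δw hδw hW).S = S0NAt d Lc (toSite r) cE cVH cΛ := rfl

/-- [folklore] The second-order part of the datum is the given `W`. -/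
@[simp] theorem jsBal0NAtOf_W (hLc : 1 ≤ Lc) {r : Fin (d + 1) → ℕ} (hr : r ∈ box (d + 1) Lc) (cE cVH cΛ : ℝ)
    (W : Fin (d + 1) → (Fin (d + 1) → ℤ) → Fin (d + 1) → (Fin (d + 1) → ℤ) → ExpKernelCalculus.MKer (d + 1) (Fib d))
    (Cw δw : ℝ) (hδw : 0 < δw) (hW : VertexFamily₂ W Lc Cw δw) :
    (jsBal0NAtOf hLc hr cE cVH cΛ W Cw δw hδw hW).W = W := rfl

end Packaging

end Summit.QuantumFields.BalabanUV.Beta.SpineRooted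

end
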